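import Summits.Ventures.YMGap.FlowData.RectTubeExcitedEigenvalue
import Summits.Ventures.YMGap.FlowData.RectTubeMassGapPrimePos
import HarnessLib

/-!
# Venture YMGap, track Y3 FLOW-DATA — `λ̂*` of the SU(2) rectangular tube is an attained eigenvalue, HYPOTHESIS-FREE
# (theorems only; joins `RectTubeExcitedEigenvalue` with `RectTubeMassGapPrimePos`)

HONEST FRAMING: venture file of the cell `pub-ymgap` (QuantumFields programme), track Y3; discharges the positivity
hypothesis of `RectTubeExcitedEigenvalue.su2_exists_eigenvector_rectExcitedNorm` by the tree theorem
`su2_rectExcitedNorm_pos` (given an axis `μ`).  For every `β > 0` and side vector `Ls` (with at least one axis): the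
excited trivial-flux top `λ̂* = su2RectExcitedNorm β Ls` of FLOW-PLAN O5 is an EIGENVALUE of `T̂`, attained on a unit
trivial-flux state orthogonal to the vacuum, and `m′ = su2RectMassGapPrime β Ls = log λ̂₀ − log λ̂*` is the logarithm of
a ratio of two genuine eigenvalues `0 < λ̂* < λ̂₀`.  Finite tube; no number, no row; nothing about `L → ∞`, the
continuum or a mass gap in the thermodynamic sense.

References: M. Reed, B. Simon I (1980) Thm VI.16 [cite: ReedSimonI1980, Thm. VI.16]; IV (1978) XIII.12
[cite: ReedSimonIV1978, Thm XIII.44].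
-/

noncomputable section

open scoped InnerProductSpace
open MeasureTheory
open Literature.MathematicalPhysics.QuantumLattice (fundamentalRep continuous_fundamentalRep fundamentalRep_mem_unitaryGroup)

namespace Summit.Ventures.YMGap.FlowData

variable {k : ℕ}

/-- ★ **`λ̂*` is an attained eigenvalue, hypothesis-free**: for `β > 0`, a side vector `Ls` and any axis `μ : Fin k`
(witnessing `k ≥ 1`), there are a unit vacuum `φ₀` (`T̂ φ₀ = λ̂₀ φ₀`) and a unit `φ` with `P_0 φ = φ`, `⟪φ₀, φ⟫ = 0`,
`T̂ φ = λ̂* φ`, `0 < λ̂* < λ̂₀`, and `su2RectMassGapPrime β Ls = log λ̂₀ − log λ̂*`. [cite: ReedSimonI1980, Thm. VI.16] -/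
theorem su2_exists_eigenvector_rectExcitedNorm' {β : ℝ} (hβ : 0 < β) (Ls : Fin k → ℕ) [∀ i, NeZero (Ls i)]
    (μ : Fin k) :
    ∃ φ₀ φ : Lp ℝ 2 (rectSliceMeasure (Matrix.specialUnitaryGroup (Fin 2) ℂ) Ls), ‖φ₀‖ = 1 ∧ ‖φ‖ = 1 ∧
      rectTubeTransferOperator (fundamentalRep (Fin 2)) (β / 2) Ls φ₀ =
        ‖rectTubeTransferOperator (fundamentalRep (Fin 2)) (β / 2) Ls‖ • φ₀ ∧
      rectTubeFluxProjection su2MinusOne Ls 0 φ = φ ∧ @inner ℝ _ _ φ₀ φ = 0 ∧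
      rectTubeTransferOperator (fundamentalRep (Fin 2)) (β / 2) Ls φ = su2RectExcitedNorm β Ls • φ ∧
      0 < su2RectExcitedNorm β Ls ∧
      su2RectExcitedNorm β Ls < ‖rectTubeTransferOperator (fundamentalRep (Fin 2)) (β / 2) Ls‖ ∧
      su2RectMassGapPrime β Ls =
        Real.log ‖rectTubeTransferOperator (fundamentalRep (Fin 2)) (β / 2) Ls‖ - Real.log (su2RectExcitedNorm β Ls) := by
  haveI : SecondCountableTopology (Matrix.specialUnitaryGroup (Fin 2) ℂ) :=
    Literature.MathematicalPhysics.QuantumLattice.secondCountableTopology_su2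
  have hpos := su2_rectExcitedNorm_pos hβ Ls μ
  obtain ⟨φ₀, φ, h01, hφ1, h0eig, hPφ, hinner, hTφ, hm⟩ := su2_exists_eigenvector_rectExcitedNorm hβ Ls hpos
  have hlt : su2RectExcitedNorm β Ls < ‖rectTubeTransferOperator (fundamentalRep (Fin 2)) (β / 2) Ls‖ :=
    rectTubeExcitedNorm_lt_norm (fundamentalRep (Fin 2)) (β / 2) (continuous_fundamentalRep (Fin 2))
      fundamentalRep_mem_unitaryGroup su2MinusOne_mem_center su2MinusOne_mul_self
  exact ⟨φ₀, φ, h01, hφ1, h0eig, hPφ, hinner, hTφ, hpos, hlt, hm⟩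

end Summit.Ventures.YMGap.FlowData
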